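import Summits.RiemannHypothesis.RiemannHypothesis.Theorems.PfPersistenceDilationProfile
import Summits.RiemannHypothesis.RiemannHypothesis.Theorems.EvenSectorBartaEvenOneSignedWindowsEdgeChannel
import Summits.RiemannHypothesis.RiemannHypothesis.Theorems.WeilWindowFlowGronwallLeakageHadamardVariation
import HarnessLib

/-!
# The Hadamard–Hellmann–Feynman EDGE LAW for the window bottom of the Weil form, virial form
# (pub-rhpf, theory-1; helper for crux `EvenSectorBarta.EvenOneSignedWindows`,
# item stmt-RiemannHypothesis-19953; RH-free)

**mechanism/rigidity campaign; no RH claims.**  Companion text: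
`run/shared/lean/pub/pub-rhpf/pub-rhpf-theory-1/THEORY-EDGE-3.md` (and `THEORY-EDGE.md`, `-2.md`).

Setting (`Literature.NumberTheory.LFunctions`, `PfPersistenceDilationProfile.lean`):
`ε(a) = weilGroundEnergy a` is the bottom of `Re weilQuadratic` over unit tests of the window
`[-a, a]`, `IsWeilGroundState a u` a ground state, `weilDilationProfile a u` the closed form along the
dilation orbit of `u` (the dilation parameter `η` MOVES THE DOMAIN: window `a ↦ a/(1+η)`; Hadamard
1908, Garabedian–Schiffer 1952/53; forms with moving domain: Kato VII §4, VIII §§3–4), which touches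
the ground level from above with contact at `η = 0` (`eventually_weilGroundEnergy_div_le`,
`weilDilationProfile_zero`).

## PROVED here (sorry-free; holds for EVERY windowed form of this type — NOT an invariant of ζ)

* `envelope_hasDerivAt_eq` (+ one-sided `envelope_le_of_hasDerivWithinAt_Ioi`,
  `envelope_ge_of_hasDerivWithinAt_Iio`): the ONE-TOUCHING-FAMILY HELLMANN–FEYNMAN LEMMA — `f ≤ g`
  near `x₀`, `f x₀ = g x₀`, both differentiable at `x₀` ⇒ `f' = g'` (Fermat); the abstract core of
  every Hellmann–Feynman / Hadamard first-variation formula, for simple or degenerate levels.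
* `mul_deriv_weilGroundEnergy_eq_neg` (THE EDGE LAW, VIRIAL FORM): at every window `a` where `ε` is
  differentiable — a.e. `a > 0`, `ae_differentiableAt_weilGroundEnergy` (Bombieri Thm 5: `ε` is
  monotone) — and for EVERY ground state `u` of that window whose dilation profile is differentiable
  at `η = 0` with derivative `V` (the DILATION VIRIAL of `u`): `a · ε'(a) = −V`. One-sided (Dini)
  versions `neg_le_mul_deriv_weilGroundEnergy`, `mul_deriv_weilGroundEnergy_le_neg`; a.e. packaging
  `ae_mul_deriv_weilGroundEnergy_eq_neg`; `weilDilationProfile_deriv_unique` (all ground states of a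
  differentiability window have the same virial). The textbook hypotheses are traded as follows:
  "simplicity of `ε₁`" ↦ "differentiability of `ε` at `a`" (automatic a.e.); "regularity of the
  eigenvector at the edge" ↦ "differentiability of the scalar profile `η ↦ 𝓠̄(ũ_η)` at `0`"
  (for the pole and archimedean parts this holds for every `L²` window function; for the prime part
  it is differentiability of `η ↦ D_{(1+η) log n}(ũ)` at the finitely many `log n ≤ 2a` — vacuous for
  `a < ½ log 2`).
* `hasDerivAt_weilDilationProfile_of_isWeilTest` (CONSISTENCY): on a test function of the window the
  profile derivative is the tree's `weilDilationVirial g = Re W(D(g ⋆ g̃))`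
  (`hasDerivAt_re_weilQuadratic_weilDilate`; `= 𝒱_pole + 𝒱_prime + 𝒱_arch`, `weilDilationVirial_eq`).
* bookkeeping: `deriv_weilGroundEnergy_eq_neg_intensity` (`V = a·I ⇒ ε'(a) = −I`).

## DERIVED only (hypotheses typed in `PfPersistenceDilationProfile.lean` — posited, NOT proved)

* `HasEdgeIntensity u a I` (existence of the edge trace `I = τ₊² + τ₋²`) and `WeilLogPohozaevAt a`
  (the log-Pohozaev edge identity `V = 2c₀ · a · I`, `c₀ = edgeLawKernelConstant = 1/2`): under them
  `ε'(a) = −I` at every differentiability window (`deriv_weilGroundEnergy_of_logPohozaevAt`,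
  `ae_hasDerivAt_weilGroundEnergy_of_logPohozaev`), and on a ray `[a₀, ∞)` of differentiability
  windows carrying ground states with virials and even-sector intensity `2τ(a)²` the abstract
  `HadamardEdgeLaw weilGroundEnergy τ 2 a₀` of the edge-channel file follows
  (`hadamardEdgeLaw_of_logPohozaev`: the constant of PF Question H is `κ = 2` in the trace
  normalisation). THEORY-EDGE-3 §2: the pole, prime and regular-archimedean parts of `V` are bulk
  terms cancelling against the Euler–Lagrange equation paired with the dilation generator `x u'`;
  what survives is the flux of the `c₀/t` singularity through the two edges — the order-zero
  analogue of the fractional Pohozaev/Hadamard identity (Ros-Oton–Serra, ARMA 213 (2014) Thm 1.1;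
  Djitte–Fall–Weth, Calc. Var. 60 (2021) Thm 1.1, `Γ(1+s)² ↦ 2c₀ = 1`).

References: J. Hadamard (1908); P. R. Garabedian, M. Schiffer, J. Anal. Math. 2 (1952/53) 281–368;
T. Kato, *Perturbation Theory for Linear Operators*, VII §4, VIII §§3–4; E. Bombieri, Rend. Mat.
Acc. Lincei (9) 11 (2000) §4; X. Ros-Oton, J. Serra, ARMA 213 (2014) 587–628; S. M. Djitte,
M. M. Fall, T. Weth, Calc. Var. PDE 60 (2021) art. 231 (arXiv:2002.07719); H. Chen, T. Weth, Comm.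
PDE 44 (2019) 1100–1139.
-/

set_option linter.dupNamespace false

noncomputable section

open MeasureTheory Set Filter
open scoped Topology

namespace Summit.RiemannHypothesis.RiemannHypothesis.Theorems.PfPersistence

open Literature.NumberTheory.LFunctions
open Summit.RiemannHypothesis.RiemannHypothesis.Theorems.WeilWindowFlowGronwallLeakage
  (ae_differentiableAt_weilGroundEnergy)
open Summit.RiemannHypothesis.RiemannHypothesis.Theorems.PolarPerronFrobenius (HadamardEdgeLaw)

/-! ## The one-touching-family Hellmann–Feynman (envelope) lemma -/

/-- **Envelope lemma / Hellmann–Feynman for one touching family.** If `f ≤ g` near `x₀`,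
`f x₀ = g x₀`, and both are differentiable at `x₀`, then `f' = g'` (`g − f` has a local minimum at
`x₀`, Fermat). Applied with `f` = the ground level along a parameter and `g` = the form on ONE trial
family touching the level, this is the Hellmann–Feynman theorem without any simplicity or
regularity hypothesis beyond the two scalar derivatives. [folklore] -/
theorem envelope_hasDerivAt_eq {f g : ℝ → ℝ} {x₀ f' g' : ℝ} (hle : ∀ᶠ x in 𝓝 x₀, f x ≤ g x)
    (heq : f x₀ = g x₀) (hf : HasDerivAt f f' x₀) (hg : HasDerivAt g g' x₀) : f' = g' := by
  have hmin : IsLocalMin (fun x ↦ g x - f x) x₀ :=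
    hle.mono fun x hx ↦ by dsimp only; linarith
  have h0 : g' - f' = 0 := hmin.hasDerivAt_eq_zero (hg.sub hf)
  linarith

/-- One-sided envelope lemma, right side: if `f ≤ g` to the right of `x₀`, `f x₀ = g x₀`, `f` is
differentiable at `x₀` and `g` has right derivative `g'` at `x₀`, then `f' ≤ g'`. [folklore] -/
theorem envelope_le_of_hasDerivWithinAt_Ioi {f g : ℝ → ℝ} {x₀ f' g' : ℝ}
    (hle : ∀ᶠ x in 𝓝[>] x₀, f x ≤ g x) (heq : f x₀ = g x₀) (hf : HasDerivAt f f' x₀)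
    (hg : HasDerivWithinAt g g' (Ioi x₀) x₀) : f' ≤ g' := by
  have hf' : Tendsto (slope f x₀) (𝓝[>] x₀) (𝓝 f') :=
    (hasDerivAt_iff_tendsto_slope_left_right.1 hf).2
  have hg' : Tendsto (slope g x₀) (𝓝[>] x₀) (𝓝 g') :=
    (hasDerivWithinAt_iff_tendsto_slope' (show x₀ ∉ Ioi x₀ from lt_irrefl x₀)).1 hg
  refine le_of_tendsto_of_tendsto hf' hg' ?_
  filter_upwards [hle, self_mem_nhdsWithin] with x hx hx'
  rw [slope_def_field, slope_def_field, heq]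
  exact div_le_div_of_nonneg_right (by linarith) (by linarith [mem_Ioi.1 hx'])

/-- One-sided envelope lemma, left side: if `f ≤ g` to the left of `x₀`, `f x₀ = g x₀`, `f` is
differentiable at `x₀` and `g` has left derivative `g'` at `x₀`, then `g' ≤ f'`. [folklore] -/
theorem envelope_ge_of_hasDerivWithinAt_Iio {f g : ℝ → ℝ} {x₀ f' g' : ℝ}
    (hle : ∀ᶠ x in 𝓝[<] x₀, f x ≤ g x) (heq : f x₀ = g x₀) (hf : HasDerivAt f f' x₀)
    (hg : HasDerivWithinAt g g' (Iio x₀) x₀) : g' ≤ f' := by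
  have hf' : Tendsto (slope f x₀) (𝓝[<] x₀) (𝓝 f') :=
    (hasDerivAt_iff_tendsto_slope_left_right.1 hf).1
  have hg' : Tendsto (slope g x₀) (𝓝[<] x₀) (𝓝 g') :=
    (hasDerivWithinAt_iff_tendsto_slope' (show x₀ ∉ Iio x₀ from lt_irrefl x₀)).1 hg
  refine le_of_tendsto_of_tendsto hg' hf' ?_
  filter_upwards [hle, self_mem_nhdsWithin] with x hx hx'
  rw [slope_def_field, slope_def_field, heq]
  exact div_le_div_of_nonpos_of_le (by linarith [mem_Iio.1 hx']) (by linarith)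

/-- Chain rule for the window variable: if `ε` has derivative `ε'` at `a`, then
`η ↦ ε(a/(1+η))` has derivative `−a ε'` at `η = 0`. [folklore] -/
theorem hasDerivAt_comp_window_div {e : ℝ → ℝ} {a e' : ℝ} (he : HasDerivAt e e' a) :
    HasDerivAt (fun η : ℝ ↦ e (a / (1 + η))) (-a * e') 0 := by
  have h1 : HasDerivAt (fun η : ℝ ↦ a / (1 + η)) (-a) 0 := by
    have hi : HasDerivAt (fun η : ℝ ↦ 1 + η) 1 0 := by
      simpa using (hasDerivAt_id (0 : ℝ)).const_add 1
    have h2 := (hi.inv (by norm_num)).const_mul a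
    have h3 : HasDerivAt (fun η : ℝ ↦ a / (1 + η)) (a * (-1 / (1 + 0) ^ 2)) 0 := by
      refine h2.congr_of_eventuallyEq (Eventually.of_forall fun η ↦ ?_)
      show a / (1 + η) = a * (1 + η)⁻¹
      rw [div_eq_mul_inv]
    exact h3.congr_deriv (by norm_num)
  have he' : HasDerivAt e e' (a / (1 + 0)) := by rwa [add_zero, div_one]
  have h4 : HasDerivAt (fun η : ℝ ↦ e (a / (1 + η))) (e' * -a) 0 := he'.comp 0 h1
  exact h4.congr_deriv (by ring)


/-! ## The edge law in virial form -/

/-- **The Hadamard–Hellmann–Feynman edge law for the Weil window bottom, virial form.** Let `a` be a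
window at which `ε = weilGroundEnergy` is differentiable (true at almost every `a > 0`,
`ae_differentiableAt_weilGroundEnergy`), `u` ANY ground state of the window `a`, and suppose the
dilation profile of `u` is differentiable at `η = 0` with derivative `V` (the dilation virial of
`u`). Then `a · ε'(a) = −V`. No simplicity of the level, no regularity of `u`. [folklore] -/
theorem mul_deriv_weilGroundEnergy_eq_neg {a : ℝ} {u : ℝ → ℂ} (hu : IsWeilGroundState a u)
    (hd : DifferentiableAt ℝ weilGroundEnergy a) {V : ℝ}
    (hV : HasDerivAt (weilDilationProfile a u) V 0) : a * deriv weilGroundEnergy a = -V := by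
  have he := hasDerivAt_comp_window_div hd.hasDerivAt
  have heq : weilGroundEnergy (a / (1 + 0)) = weilDilationProfile a u 0 := by
    rw [add_zero, div_one, weilDilationProfile_zero hu]
  have h := envelope_hasDerivAt_eq (eventually_weilGroundEnergy_div_le hu) heq he hV
  linarith

/-- One-sided edge law (compression side): a right derivative `V₊` of the profile at `0` bounds
`−a ε'(a) ≤ V₊`. [folklore] -/
theorem neg_le_mul_deriv_weilGroundEnergy {a : ℝ} {u : ℝ → ℂ} (hu : IsWeilGroundState a u)
    (hd : DifferentiableAt ℝ weilGroundEnergy a) {V : ℝ}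
    (hV : HasDerivWithinAt (weilDilationProfile a u) V (Ioi 0) 0) :
    -V ≤ a * deriv weilGroundEnergy a := by
  have he := hasDerivAt_comp_window_div hd.hasDerivAt
  have heq : weilGroundEnergy (a / (1 + 0)) = weilDilationProfile a u 0 := by
    rw [add_zero, div_one, weilDilationProfile_zero hu]
  have h := envelope_le_of_hasDerivWithinAt_Ioi
    ((eventually_weilGroundEnergy_div_le hu).filter_mono nhdsWithin_le_nhds) heq he hV
  linarith

/-- One-sided edge law (expansion side): a left derivative `V₋` of the profile at `0` bounds
`V₋ ≤ −a ε'(a)`. [folklore] -/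
theorem mul_deriv_weilGroundEnergy_le_neg {a : ℝ} {u : ℝ → ℂ} (hu : IsWeilGroundState a u)
    (hd : DifferentiableAt ℝ weilGroundEnergy a) {V : ℝ}
    (hV : HasDerivWithinAt (weilDilationProfile a u) V (Iio 0) 0) :
    a * deriv weilGroundEnergy a ≤ -V := by
  have he := hasDerivAt_comp_window_div hd.hasDerivAt
  have heq : weilGroundEnergy (a / (1 + 0)) = weilDilationProfile a u 0 := by
    rw [add_zero, div_one, weilDilationProfile_zero hu]
  have h := envelope_ge_of_hasDerivWithinAt_Iio
    ((eventually_weilGroundEnergy_div_le hu).filter_mono nhdsWithin_le_nhds) heq he hV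
  linarith

/-- **The edge law holds at almost every window**: for a.e. `a > 0`, every ground state `u` of the
window `a` with a differentiable dilation profile has virial `V = −a ε'(a)`; in particular all
ground states of such a window have the SAME virial. [folklore] -/
theorem ae_mul_deriv_weilGroundEnergy_eq_neg :
    ∀ᵐ a : ℝ, 0 < a → ∀ (u : ℝ → ℂ) (V : ℝ), IsWeilGroundState a u →
      HasDerivAt (weilDilationProfile a u) V 0 → a * deriv weilGroundEnergy a = -V := by
  filter_upwards [ae_differentiableAt_weilGroundEnergy] with a ha hpos u V hu hV
  exact mul_deriv_weilGroundEnergy_eq_neg hu (ha hpos) hV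

/-- Two ground states of the same (differentiability) window with differentiable profiles have the
same virial. [folklore] -/
theorem weilDilationProfile_deriv_unique {a : ℝ} {u v : ℝ → ℂ} (hu : IsWeilGroundState a u)
    (hv : IsWeilGroundState a v) (hd : DifferentiableAt ℝ weilGroundEnergy a) {V W : ℝ}
    (hV : HasDerivAt (weilDilationProfile a u) V 0) (hW : HasDerivAt (weilDilationProfile a v) W 0) :
    V = W := by
  have h1 := mul_deriv_weilGroundEnergy_eq_neg hu hd hV
  have h2 := mul_deriv_weilGroundEnergy_eq_neg hv hd hW
  linarith

/-! ## Consistency with Bombieri's dilation virial on test functions -/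

/-- A test function supported in `[-a, a]` vanishes at every `|x| ≥ a` (its support is open and
contained in `[-a, a]`, hence in `(-a, a)`). [folklore] -/
theorem eq_zero_of_le_abs_of_tsupport_subset {g : ℝ → ℂ} (hg : IsWeilTest g) {a : ℝ}
    (hsupp : tsupport g ⊆ Icc (-a) a) {x : ℝ} (hx : a ≤ |x|) : g x = 0 := by
  have hopen : IsOpen (Function.support g) := hg.1.continuous.isOpen_support
  have hsub : Function.support g ⊆ Ioo (-a) a := by
    rw [← interior_Icc]
    exact hopen.subset_interior_iff.2 ((subset_tsupport g).trans hsupp)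
  by_contra h
  have hx' : x ∈ Ioo (-a) a := hsub (Function.mem_support.2 h)
  exact hx.not_gt (abs_lt.2 hx')

/-- **On test functions the profile derivative is the dilation virial**: for a test function `g` of
the window `[-a, a]`, `HasDerivAt (weilDilationProfile a g) (weilDilationVirial g) 0`
(`hasDerivAt_re_weilQuadratic_weilDilate`; the closed form is `Re Q` on the dilates, which are tests
supported in `[-2a, 2a]` for `η > -1/2`). So the virial `V` of the edge law is the closed extension
of `weilDilationVirial = Re W(D(g ⋆ g̃))`, `D = t d/dt`. [cite: Bombieri2000Weil, §4 proof of Thm 5 (the dilation)] -/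
theorem hasDerivAt_weilDilationProfile_of_isWeilTest {g : ℝ → ℂ} (hg : IsWeilTest g) {a : ℝ}
    (ha : 0 < a) (hsupp : tsupport g ⊆ Icc (-a) a) :
    HasDerivAt (weilDilationProfile a g) (weilDilationVirial g) 0 := by
  have htr : weilTrunc a g = g :=
    weilTrunc_eq_self fun x hx ↦ eq_zero_of_le_abs_of_tsupport_subset hg hsupp hx
  refine (hasDerivAt_re_weilQuadratic_weilDilate hg).congr_of_eventuallyEq ?_
  filter_upwards [Ioi_mem_nhds (show (-(1 / 2 : ℝ)) < 0 by norm_num)] with η hη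
  have hη0 : -(1 / 2 : ℝ) < η := mem_Ioi.1 hη
  have hη' : -1 < η := by linarith
  have hc : 0 < 1 + η := by linarith
  have hsub : Icc (-(a / (1 + η))) (a / (1 + η)) ⊆ Icc (-(2 * a)) (2 * a) := by
    have h : a / (1 + η) ≤ 2 * a := by
      rw [div_le_iff₀ hc]
      have : 0 ≤ a * (1 + 2 * η) := mul_nonneg ha.le (by linarith)
      linarith
    exact Icc_subset_Icc (by linarith) h
  show weilDilationProfile a g η = (weilQuadratic (weilDilate η g)).re
  unfold weilDilationProfile
  rw [htr, weilClosedForm_eq_re_weilQuadratic (hg.weilDilate hη')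
    ((tsupport_weilDilate_subset g hη' hsupp).trans hsub)]

/-! ## Under the DERIVED log-Pohozaev identity: `ε'(a) = −I` and the constant of Question H -/

/-- Bookkeeping: if the virial of a ground state of a differentiability window equals `a · I`, then
`ε'(a) = −I`. (PROVED; the hypothesis `V = a I` is the derived log-Pohozaev identity.) [folklore] -/
theorem deriv_weilGroundEnergy_eq_neg_intensity {a : ℝ} {u : ℝ → ℂ} (hu : IsWeilGroundState a u)
    (hd : DifferentiableAt ℝ weilGroundEnergy a) {V I : ℝ}
    (hV : HasDerivAt (weilDilationProfile a u) V 0) (hPoh : V = a * I) :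
    deriv weilGroundEnergy a = -I := by
  have ha : 0 < a := hu.pos
  have h := mul_deriv_weilGroundEnergy_eq_neg hu hd hV
  rw [hPoh] at h
  have h' : a * (deriv weilGroundEnergy a + I) = 0 := by linarith
  rcases mul_eq_zero.1 h' with h0 | h0
  · exact absurd h0 ha.ne'
  · linarith

/-- Under the log-Pohozaev identity at a differentiability window `a`: `ε'(a) = −I(u)` for every
ground state `u` of the window with a virial and an edge intensity. [folklore] -/
theorem deriv_weilGroundEnergy_of_logPohozaevAt {a : ℝ} {u : ℝ → ℂ} (hP : WeilLogPohozaevAt a)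
    (hu : IsWeilGroundState a u) (hd : DifferentiableAt ℝ weilGroundEnergy a) {V I : ℝ}
    (hV : HasDerivAt (weilDilationProfile a u) V 0) (hI : HasEdgeIntensity u a I) :
    deriv weilGroundEnergy a = -I := by
  have h := hP u V I hu hV hI
  norm_num [edgeLawKernelConstant] at h
  exact deriv_weilGroundEnergy_eq_neg_intensity hu hd hV h

/-- Under the log-Pohozaev identity at a differentiability window `a`: `HasDerivAt ε (−I) a`.
[folklore] -/
theorem hasDerivAt_weilGroundEnergy_of_logPohozaevAt {a : ℝ} {u : ℝ → ℂ}
    (hP : WeilLogPohozaevAt a) (hu : IsWeilGroundState a u)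
    (hd : DifferentiableAt ℝ weilGroundEnergy a) {V I : ℝ}
    (hV : HasDerivAt (weilDilationProfile a u) V 0) (hI : HasEdgeIntensity u a I) :
    HasDerivAt weilGroundEnergy (-I) a := by
  rw [← deriv_weilGroundEnergy_of_logPohozaevAt hP hu hd hV hI]
  exact hd.hasDerivAt

/-- Under the log-Pohozaev identity the edge law `ε'(a) = −(τ₊² + τ₋²)` holds at almost every
window. [folklore] -/
theorem ae_hasDerivAt_weilGroundEnergy_of_logPohozaev (hP : ∀ a, 0 < a → WeilLogPohozaevAt a) :
    ∀ᵐ a : ℝ, 0 < a → ∀ (u : ℝ → ℂ) (V I : ℝ), IsWeilGroundState a u →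
      HasDerivAt (weilDilationProfile a u) V 0 → HasEdgeIntensity u a I →
        HasDerivAt weilGroundEnergy (-I) a := by
  filter_upwards [ae_differentiableAt_weilGroundEnergy] with a ha hpos u V I hu hV hI
  exact hasDerivAt_weilGroundEnergy_of_logPohozaevAt (hP a hpos) hu (ha hpos) hV hI

/-- **The constant of Question H is `κ = 2` in the trace normalisation** (PROVED bookkeeping): on a
ray `[a₀, ∞)` of windows where the log-Pohozaev identity holds, `ε` is differentiable, and some
ground state has a virial and the even-sector edge intensity `I(a) = 2 τ(a)²`, the abstract
`HadamardEdgeLaw weilGroundEnergy τ 2 a₀` of the edge-channel file holds. [folklore] -/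
theorem hadamardEdgeLaw_of_logPohozaev {a₀ : ℝ} (τ : ℝ → ℝ)
    (hP : ∀ a, a₀ ≤ a → WeilLogPohozaevAt a)
    (hd : ∀ a, a₀ ≤ a → DifferentiableAt ℝ weilGroundEnergy a)
    (hex : ∀ a, a₀ ≤ a → ∃ (u : ℝ → ℂ) (V : ℝ), IsWeilGroundState a u ∧
      HasDerivAt (weilDilationProfile a u) V 0 ∧ HasEdgeIntensity u a (2 * τ a ^ 2)) :
    HadamardEdgeLaw weilGroundEnergy τ 2 a₀ := by
  refine ⟨two_pos, fun a ha ↦ ?_⟩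
  obtain ⟨u, V, hu, hV, hI⟩ := hex a ha
  exact hasDerivAt_weilGroundEnergy_of_logPohozaevAt (hP a ha) hu (hd a ha) hV hI

end Summit.RiemannHypothesis.RiemannHypothesis.Theorems.PfPersistence

end
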